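import Mathlib
import HarnessLib
import HarnessLib.Audit
import Summits.Langlands.Statement
import Summits.Langlands.Langlands.Theses.TowerDoorSplit
import Literature.NumberTheory.EllipticCurves.HasseWeilGoodReduction
import Literature.FieldTheory.AlgClosed.PadicAlgClEquivComplex
import Literature.NumberTheory.EllipticCurves.AdmissiblePrimeSupply

/-!
# DepthIsolationSplit — lens-5 g26 node on REST = `TowerDoorSplit.UnanchoredHighDegreeWitnessAutomorphy`
(stmt-Langlands-26998, the DECLARED RESIDUAL of route-Langlands-TowerDoorSplit), refined AT ITS REGISTERED
E-LEVEL STUB `stub_unanchored` (`Cruxes/UnanchoredHighDegreeWitnessAutomorphy/Lines/birth.lean`):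
«every integral elliptic curve over an unanchored totally real field of degree ≥ 6 is modular».

AXIS (finite/base range + asymptotic regime + bridge, in the currency of CONGRUENCE DEPTH):

* currency `HasDepthApproximant K₀ E p C` — a parallel-weight-2 cuspidal `π` on `GL₂/K₀`, spherical at every
  place `w ∤ p` of good reduction of `E`, whose Hecke eigenvalues lie `p`-adically in a multiquadratic
  extension of the `p`-adic floor `E₀(K₀,p)` and are congruent to `a_w(E)` modulo `p ^ C` at almost all `w`;
* ISOL `FiniteDepthIsolation` (asymptotic regime, PRINT modulo bookkeeping): for `E` good ordinary above `p`
  there is a FINITE depth `C` beyond which a depth-`C` approximant forces `E` modular — Thorne,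
  arXiv:2608.07186, Thm 4.1 (`C(ρ)`; NO hypothesis on the residual image) + Lemma 4.2 + Prop 2.13, with
  solvable totally real base change / descent and the local consequences of a deep congruence;
* SUPPLY `IsolatingDepthCongruence` (finite range, the DECLARED RESIDUAL in a new currency): a depth-`d`
  approximant exists at SOME ordinary prime `p` at the least isolating depth `d = isolationDepth K₀ E p` (one
  weight-2 Hilbert newform congruent to `E` to an explicit finite depth at ONE ordinary prime: a finite certificate
  per curve);
* bridge: the isolating depth is FINITE and the ordinary prime is FREE (SUPPLY chooses `p`); the necessity
  certificates use ORD∞ = the tree named fact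
  `Literature.NumberTheory.EllipticCurves.infinite_setOf_prime_goodOrdinaryAbove` BY NAME (Serre 1981; the kit
  keeps the verbatim copy `OrdinaryPrimeSupply` with `ordinaryPrimeSupply_iff : _ ↔ _ := Iff.rfl`) and LGC.

KERNEL: `restE_of_pieces : ISOL → SUPPLY → REST_E` and `closes_target : … → REST` BY NAME through the other
four registered stubs of REST's birth skeleton (IMT text, TRANY = item 31038 by name, W⁺|₂ text, R1 = item
24805 by name); necessity `isolation_of_modularE : REST_E → ISOL`, `supply_of_modularE : LGC → REST_E → SUPPLY`
(ORD∞, LGC = print junctions used ONLY on the necessity side: infinitely many ordinary primes; weight-2 local–global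
compatibility at good places); `restE_iff_pieces`.
0 sorry; axioms of `closes_target` expected [propext, Classical.choice, Quot.sound].
-/

set_option linter.dupNamespace false
set_option linter.unusedVariables false

open scoped NumberField Classical
open Filter IsDedekindDomain
open Literature.NumberTheory.Automorphic Literature.NumberTheory.GaloisRepresentations

namespace Summit.Langlands.Langlands.Theorems.DepthIsolationSplit

/-! ## §0 The target at E-level and its box -/

/-- The four side conditions of REST at E-level, bundled: `K₀` totally real of degree `≥ 6`, not in the
abelian-or-cyclotomic locus (A), not a 15-stable odd solvable cover of a field of degree `≤ 5` (B5), not a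
21-stable one (B7) — verbatim the hypotheses of the registered stub `stub_unanchored`. -/
def UnanchoredBox (K₀ : Type) [Field K₀] [NumberField K₀] : Prop :=
  NumberField.IsTotallyReal K₀ ∧ ¬ (Module.finrank ℚ K₀ ≤ 5) ∧
  ¬ ((IsGalois ℚ K₀ ∧ (∀ σ τ : K₀ ≃ₐ[ℚ] K₀, σ * τ = τ * σ) ∧ ¬ ((3 : ℤ) ∣ NumberField.discr K₀) ∧ ¬ ((5 : ℤ) ∣ NumberField.discr K₀) ∧ ¬ ((7 : ℤ) ∣ NumberField.discr K₀)) ∨ (∃ p : ℕ, p.Prime ∧ Literature.NumberTheory.Automorphic.Thorne2019.IsInCyclotomicZpExtension p K₀)) ∧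
  ¬ (¬ IsSquare (5 : K₀) ∧ ∃ F : IntermediateField ℚ K₀, Module.finrank ℚ F ≤ 5 ∧ IsGalois F K₀ ∧ IsSolvable (K₀ ≃ₐ[F] K₀) ∧ Odd (Module.finrank F K₀) ∧ ∀ x y : K₀, (Literature.NumberTheory.Automorphic.Thorne2019.E₁.baseChange K₀).toAffine.Equation x y → x ∈ Set.range (algebraMap F K₀) ∧ y ∈ Set.range (algebraMap F K₀)) ∧
  ¬ (¬ ((7 : ℤ) ∣ NumberField.discr K₀) ∧ ∃ F : IntermediateField ℚ K₀, Module.finrank ℚ F ≤ 5 ∧ IsGalois F K₀ ∧ IsSolvable (K₀ ≃ₐ[F] K₀) ∧ Odd (Module.finrank F K₀) ∧ ∀ x y : K₀, ((⟨1, 0, 0, -4, -1⟩ : WeierstrassCurve ℚ).baseChange K₀).toAffine.Equation x y → x ∈ Set.range (algebraMap F K₀) ∧ y ∈ Set.range (algebraMap F K₀))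

/-- REST at E-level (REST_E) — the TYPE of the registered birth stub `stub_unanchored` of
`TowerDoorSplit.UnanchoredHighDegreeWitnessAutomorphy` VERBATIM: every integral `E` (`Δ ≠ 0`) over every
unanchored totally real field of degree `≥ 6` is modular. (IDEA-NEEDED; no print.) -/
def UnanchoredHighDegreeModularE : Prop :=
  ∀ (K₀ : Type) [Field K₀] [NumberField K₀], NumberField.IsTotallyReal K₀ → ¬ (Module.finrank ℚ K₀ ≤ 5) → ¬ ((IsGalois ℚ K₀ ∧ (∀ σ τ : K₀ ≃ₐ[ℚ] K₀, σ * τ = τ * σ) ∧ ¬ ((3 : ℤ) ∣ NumberField.discr K₀) ∧ ¬ ((5 : ℤ) ∣ NumberField.discr K₀) ∧ ¬ ((7 : ℤ) ∣ NumberField.discr K₀)) ∨ (∃ p : ℕ, p.Prime ∧ Literature.NumberTheory.Automorphic.Thorne2019.IsInCyclotomicZpExtension p K₀)) → ¬ (¬ IsSquare (5 : K₀) ∧ ∃ F : IntermediateField ℚ K₀, Module.finrank ℚ F ≤ 5 ∧ IsGalois F K₀ ∧ IsSolvable (K₀ ≃ₐ[F] K₀) ∧ Odd (Module.finrank F K₀)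 ∧ ∀ x y : K₀, (Literature.NumberTheory.Automorphic.Thorne2019.E₁.baseChange K₀).toAffine.Equation x y → x ∈ Set.range (algebraMap F K₀) ∧ y ∈ Set.range (algebraMap F K₀)) → ¬ (¬ ((7 : ℤ) ∣ NumberField.discr K₀) ∧ ∃ F : IntermediateField ℚ K₀, Module.finrank ℚ F ≤ 5 ∧ IsGalois F K₀ ∧ IsSolvable (K₀ ≃ₐ[F] K₀) ∧ Odd (Module.finrank F K₀) ∧ ∀ x y : K₀, ((⟨1, 0, 0, -4, -1⟩ : WeierstrassCurve ℚ).baseChange K₀).toAffine.Equation x y → x ∈ Set.range (algebraMap F K₀) ∧ y ∈ Set.range (algebraMap F K₀)) → ∀ E : WeierstrassCurve (NumberField.RingOfIntegers K₀), E.Δ ≠ 0 → Literature.NumberTheory.Automorphic.IsModularEllipticCurve K₀ E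

/-- REST_E in box form. -/
theorem modularE_iff_box : UnanchoredHighDegreeModularE ↔
    ∀ (K₀ : Type) [Field K₀] [NumberField K₀], UnanchoredBox K₀ →
      ∀ E : WeierstrassCurve (𝓞 K₀), E.Δ ≠ 0 → IsModularEllipticCurve K₀ E :=
  ⟨fun h K₀ _ _ hb E hΔ => h K₀ hb.1 hb.2.1 hb.2.2.1 hb.2.2.2.1 hb.2.2.2.2 E hΔ,
   fun h K₀ _ _ h1 h2 h3 h4 h5 E hΔ => h K₀ ⟨h1, h2, h3, h4, h5⟩ E hΔ⟩

/-! ## §1 The currency: congruence depth of a weight-2 modular approximant -/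

/-- `E/K₀` has GOOD ORDINARY reduction at every prime above `p` — verbatim the clause of the tree fact
`infinite_setOf_prime_goodOrdinaryAbove`: the local polynomial at `𝔭 ∣ p` (Mathlib's
`WeierstrassCurve.localPolynomial` on a minimal model) has degree `2` (good reduction) and `p ∤ a_𝔭`. -/
def IsGoodOrdinaryAbove (K₀ : Type) [Field K₀] [NumberField K₀] (V : WeierstrassCurve K₀) (p : ℕ) : Prop :=
  ∀ 𝔭 : HeightOneSpectrum (𝓞 K₀), (p : 𝓞 K₀) ∈ 𝔭.asIdeal →
    ((V.baseChange (𝔭.adicCompletion K₀)).localPolynomial (𝔭.adicCompletionIntegers K₀)).natDegree = 2 ∧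
    ¬ (p : ℤ) ∣ ((V.baseChange (𝔭.adicCompletion K₀)).localPolynomial
      (𝔭.adicCompletionIntegers K₀)).coeff 1

/-- The `p`-adic floor of `K₀`: all values of all `p`-adic embeddings of `K₀` (generates Thorne's `E₀`). -/
def padicFloor (K₀ : Type) [Field K₀] (p : ℕ) [Fact p.Prime] : Set (PadicAlgCl p) :=
  ⋃ φ : K₀ →+* PadicAlgCl p, Set.range φ

/-- DEPTH-`C` MODULAR APPROXIMANT of `E` at `p` over `K₀` (trace currency). There are a parallel-weight-2
(`HasWeightZero`) cuspidal `π` on `GL₂/K₀`, an identification `ι : ℚ̄_p ≃ ℂ` and finitely many square roots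
`s` over the `p`-adic floor such that (LEVEL) `π` is spherical at every place `w ∤ p` where `E` has good
reduction, and (CONGRUENCE) at almost every `w` the Hecke eigenvalue `t_w = √(N w)·Σα_w` of `π` lies in
`ℚ_p(floor, s)` and satisfies `|t_w − a_w(E)|_p ≤ |p ^ C|_p`. A modular non-CM `E` is its own approximant
at every depth (given local–global compatibility for the level clause: `supply_of_modularE`). -/
def HasDepthApproximant (K₀ : Type) [Field K₀] [NumberField K₀] (E : WeierstrassCurve (𝓞 K₀))
    (p : ℕ) [Fact p.Prime] (C : ℕ) : Prop :=
  ∃ (hF : isCompact_glFiniteIntegralLevel 2 K₀) (π : CuspidalAutomorphicRepData 2 K₀ hF)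
    (ι : PadicAlgCl p ≃+* ℂ) (s : Finset (PadicAlgCl p)),
    π.1.HasWeightZero ∧ (∀ a ∈ s, a ^ 2 ∈ IntermediateField.adjoin ℚ_[p] (padicFloor K₀ p)) ∧
    (∀ w : HeightOneSpectrum (𝓞 K₀), (p : 𝓞 K₀) ∉ w.asIdeal → (E.baseChange K₀).HasGoodReductionAt w →
      ∃ α : Multiset ℂ, π.1.HasSatakeParamAt w α) ∧
    ∀ᶠ w : HeightOneSpectrum (𝓞 K₀) in Filter.cofinite, ∃ (α : Multiset ℂ) (t : PadicAlgCl p),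
      π.1.HasSatakeParamAt w α ∧ ((Real.sqrt w.residueCard : ℝ) : ℂ) * α.sum = ι t ∧
      t ∈ IntermediateField.adjoin ℚ_[p] (padicFloor K₀ p ∪ (s : Set (PadicAlgCl p))) ∧
      Valued.v (t - (frobTraceAt E w : PadicAlgCl p)) ≤ Valued.v ((p : PadicAlgCl p) ^ C)

/-- A deeper approximant is a shallower one. -/
theorem HasDepthApproximant.mono {K₀ : Type} [Field K₀] [NumberField K₀] {E : WeierstrassCurve (𝓞 K₀)}
    {p : ℕ} [Fact p.Prime] {C C' : ℕ} (hle : C ≤ C') (h : HasDepthApproximant K₀ E p C') :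
    HasDepthApproximant K₀ E p C := by
  obtain ⟨hF, π, ι, s, hwt, hs, hlev, hcong⟩ := h
  refine ⟨hF, π, ι, s, hwt, hs, hlev, hcong.mono ?_⟩
  rintro w ⟨α, t, hα, hsum, hmem, hval⟩
  refine ⟨α, t, hα, hsum, hmem, hval.trans ?_⟩
  have hp1 : (1 : NNReal) ≤ (p : NNReal) := by exact_mod_cast (Fact.out : p.Prime).one_lt.le
  have hle1 : 1 / (p : NNReal) ≤ 1 := by rw [one_div]; exact inv_le_one_of_one_le₀ hp1
  rw [map_pow, map_pow, PadicAlgCl.valuation_p]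
  exact pow_le_pow_of_le_one bot_le hle1 hle

/-- The ISOLATING DEPTH `d(K₀, E, p)`: the least `C` such that a depth-`C` approximant forces `E` modular
(`sInf`, junk value `0` if there is none — `FiniteDepthIsolation` says there always is one). -/
noncomputable def isolationDepth (K₀ : Type) [Field K₀] [NumberField K₀] (E : WeierstrassCurve (𝓞 K₀))
    (p : ℕ) [Fact p.Prime] : ℕ :=
  sInf {C : ℕ | HasDepthApproximant K₀ E p C → IsModularEllipticCurve K₀ E}

/-! ## §2 The pieces -/

/-- crux ISOL (rank 2; WEAKER · ATTACKABLE│PRINT modulo bookkeeping). FINITE-DEPTH ISOLATION OF AUTOMORPHY: for an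
integral `E` over a field of the REST box, good ordinary above `p`, SOME finite congruence depth `C` isolates:
a depth-`C` weight-2 approximant forces `E` modular. Source: Thorne, arXiv:2608.07186, Thm 4.1 (explicit
`C(ρ) = max(C₀,…,3C₅+1,{C_v},ord_ϖ 2)`, congruence mod `ϖ^{80C(ρ)+1}`, NO residual-image hypothesis; needs
`det = ε⁻¹`, crystalline ordinary at `v ∣ p`, semistable, Zariski-dense projective image over `F(ζ_{p^∞})` —
automatic for non-CM `E` — and `[F:ℚ]`, `|Σ|` even) + Lemma 4.2 (depth stable in `Σ ∪ S_p`-split extensions)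
+ Prop 2.13 (= Newton–Thorne 2023 Prop 2.7: trace congruence ⇒ lattice congruence with bounded loss), run
over a solvable totally real `F₁/K₀` making `E` semistable with the parities right (Grunwald–Wang), the deep
congruence forcing the approximant's Galois representation semistable with the same `Σ`, Iwahori-ordinary at
`p` with matching unit roots and irreducible (Raynaud `e < p−1`, finite-order inertia ≢ 1 mod `p`), then
solvable descent of the modularity of `E` (cyclic layers, Langlands–Arthur–Clozel). CM `E` are modular by
definition. Why it might fail as typed: the coefficient normalisation (Thorne's `ρ'` valued in `GL₂(𝒪₁)`,
`E₁` = multiquadratic over `E₀`; here: eigenvalues in `ℚ_p(floor, √s)`) and the solvable descent step are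
print but not verbatim; depth is measured in `|p|^C` not `|ϖ|^c`. -/
def FiniteDepthIsolation : Prop :=
  ∀ (K₀ : Type) [Field K₀] [NumberField K₀], UnanchoredBox K₀ →
    ∀ (E : WeierstrassCurve (𝓞 K₀)), E.Δ ≠ 0 → ∀ (p : ℕ) [Fact p.Prime],
      IsGoodOrdinaryAbove K₀ (E.baseChange K₀) p →
        ∃ C : ℕ, (HasDepthApproximant K₀ E p C → IsModularEllipticCurve K₀ E)

/-- crux SUPPLY (rank 3; the DECLARED RESIDUAL of REST re-cut in the depth currency · INSTRUMENTABLE per curve).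
A CONGRUENCE AT THE ISOLATING DEPTH: every non-CM integral `E` over a field of the REST box admits, at SOME
prime `p` of good ordinary reduction (the attacker chooses `p`), a weight-2 modular approximant of depth
`isolationDepth K₀ E p` — ONE Hilbert newform over `K₀`, spherical at the good places of `E`, with nearly-rational
`p`-adic Hecke field, congruent to `E` modulo `p^d` for the explicit finite `d` of ISOL. Implied by REST_E given infinitely many ordinary primes and local–global compatibility (the curve's own `π`, `supply_of_modularE`);
for a fixed curve a finite computation in spaces of Hilbert modular forms of parallel weight 2. No print
towards it in general (it is modularity-strength for the box); it differs from «E[p] or E[ℓⁿ] occurs in a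
modular abelian variety over K₀» (moduli/rational points) in asking only for a CONGRUENCE of Hecke
eigenvalues, of explicit depth, at one ordinary prime, allowing congruence primes and large Hecke fields. -/
def IsolatingDepthCongruence : Prop :=
  ∀ (K₀ : Type) [Field K₀] [NumberField K₀], UnanchoredBox K₀ →
    ∀ (E : WeierstrassCurve (𝓞 K₀)), E.Δ ≠ 0 → ¬ (E.baseChange K₀).HasCM →
      ∃ (p : ℕ) (_ : Fact p.Prime), IsGoodOrdinaryAbove K₀ (E.baseChange K₀) p ∧
        HasDepthApproximant K₀ E p (isolationDepth K₀ E p)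

/-- junction ORD∞ (PRINT, Serre 1981 §8.2 Thm 20 Cor 2; Deuring for CM) — the TYPE of the tree named fact
`Literature.NumberTheory.EllipticCurves.infinite_setOf_prime_goodOrdinaryAbove` VERBATIM (identity
`ordinaryPrimeSupply_iff` below is `Iff.rfl`; the kernel theorems take the tree fact BY NAME):
every elliptic curve over a number field has infinitely many primes `p` of good ordinary reduction above `p`. -/
def OrdinaryPrimeSupply : Prop :=
  ∀ (F : Type) [Field F] [NumberField F] (V : WeierstrassCurve F) [V.IsElliptic],
    {p : ℕ | p.Prime ∧ ∀ 𝔭 : HeightOneSpectrum (𝓞 F), (p : 𝓞 F) ∈ 𝔭.asIdeal →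
      ((V.baseChange (𝔭.adicCompletion F)).localPolynomial (𝔭.adicCompletionIntegers F)).natDegree = 2 ∧
      ¬ (p : ℤ) ∣ ((V.baseChange (𝔭.adicCompletion F)).localPolynomial
        (𝔭.adicCompletionIntegers F)).coeff 1}.Infinite

/-- The vendored junction text IS the tree named fact (definitional identity). -/
theorem ordinaryPrimeSupply_iff :
    OrdinaryPrimeSupply ↔ Literature.NumberTheory.EllipticCurves.infinite_setOf_prime_goodOrdinaryAbove :=
  Iff.rfl

/-! ## §3 Kernel: the pieces give REST_E -/

/-- An integral model with `Δ ≠ 0` is an elliptic curve over `K₀`. -/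
theorem isElliptic_baseChange_of_delta_ne_zero {K₀ : Type} [Field K₀] [NumberField K₀]
    (E : WeierstrassCurve (𝓞 K₀)) (hΔ : E.Δ ≠ 0) : (E.baseChange K₀).IsElliptic := by
  refine ⟨isUnit_iff_ne_zero.mpr ?_⟩
  rw [WeierstrassCurve.baseChange, WeierstrassCurve.map_Δ]
  exact (map_ne_zero_iff _ (IsFractionRing.injective (𝓞 K₀) K₀)).mpr hΔ

/-- KERNEL (pure logic + `Nat.sInf_mem`): ISOL → SUPPLY → REST_E. For a CM curve REST_E holds by definition;
otherwise SUPPLY names an ordinary prime `p` and a depth-`d` approximant at the isolating depth `d`, which is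
well defined because ISOL provides some isolating depth at `p`; feed the approximant to ISOL. -/
theorem restE_of_pieces (hI : FiniteDepthIsolation) (hS : IsolatingDepthCongruence) :
    UnanchoredHighDegreeModularE := by
  rw [modularE_iff_box]
  intro K₀ _ _ hbox E hΔ
  by_cases hCM : (E.baseChange K₀).HasCM
  · exact IsModularEllipticCurve.of_hasCM hCM
  obtain ⟨p, hp, hpord, happ⟩ := hS K₀ hbox E hΔ hCM
  haveI : Fact p.Prime := hp
  obtain ⟨C₀, hC₀⟩ := hI K₀ hbox E hΔ p hpord
  have hmem : isolationDepth K₀ E p ∈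
      {C : ℕ | HasDepthApproximant K₀ E p C → IsModularEllipticCurve K₀ E} :=
    Nat.sInf_mem ⟨C₀, hC₀⟩
  exact hmem happ

/-! ## §4 `closes_target` (kit name `closes`, renamed for the gate's helper rule): the pieces give REST BY NAME, through the other registered stubs of its birth skeleton -/

/-- junction IMT (PRINT glue; = TYPE of the registered stub `stub_integralModel` VERBATIM): integral-model transfer
of a TR sandwich witness. -/
def IntegralModelTransferPointwise : Prop :=
  ∀ (K : Type) [Field K] [NumberField K] (ℓ : ℕ) [Fact ℓ.Prime] (ρ : Literature.NumberTheory.GaloisRepresentations.FramedGaloisRep K (PadicAlgCl ℓ) 2) (L : Type) [Field L] [NumberField L] [Algebra K L], IsGalois K L → IsSolvable (L ≃ₐ[K] L) → ∀ (K₀ : Type) [Field K₀] [NumberField K₀] [Algebra K₀ L], IsGalois K₀ L → IsSolvable (L ≃ₐ[K₀] L) → ∀ (E : WeierstrassCurve K₀) [E.IsElliptic] (χ : Literature.NumberTheory.GaloisRepresentations.FramedGaloisRep L (PadicAlgCl ℓ) 1), (∀ g : Field.absoluteGaloisGroup L, Literature.NumberTheory.GaloisRepresentations.FramedRep.trace (ρ.restrictField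 L) g = Literature.NumberTheory.GaloisRepresentations.FramedRep.trace χ g * Literature.NumberTheory.GaloisRepresentations.FramedRep.trace ((E.framedTateGaloisRep ℓ).restrictField L) g) → ∃ (E' : WeierstrassCurve (NumberField.RingOfIntegers K₀)) (_ : (E'.baseChange K₀).IsElliptic) (χ' : Literature.NumberTheory.GaloisRepresentations.FramedGaloisRep L (PadicAlgCl ℓ) 1), ∀ g : Field.absoluteGaloisGroup L, Literature.NumberTheory.GaloisRepresentations.FramedRep.trace (ρ.restrictField L) g = Literature.NumberTheory.GaloisRepresentations.FramedRep.trace χ' g * Literature.NumberTheory.GaloisRepresentations.FramedRep.trace (((E'.baseChange K₀).framedTateGaloisRep ℓ).restrictField L) g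

/-- junction W⁺|₂ (= TYPE of the registered stub `stub_avatar2` VERBATIM = host item
`EllipticDegreeLadder.SatakeAvatarExistence` at `n = 2`): Galois avatars of L-algebraic cuspidal `π` on `GL₂`. -/
def SatakeAvatarTwo : Prop :=
  ∀ (K : Type) [Field K] [NumberField K] (hcpt : Literature.NumberTheory.Automorphic.isCompact_glFiniteIntegralLevel 2 K) (π : Literature.NumberTheory.Automorphic.CuspidalAutomorphicRepData 2 K hcpt), π.1.IsLAlgebraic → ∀ (ℓ : ℕ) [Fact ℓ.Prime] (ι : PadicAlgCl ℓ ≃+* ℂ), ∃ ρ : Literature.NumberTheory.GaloisRepresentations.FramedGaloisRep K (PadicAlgCl ℓ) 2, ρ.toGaloisRep.IsIrreducible ∧ ∀ᶠ v : IsDedekindDomain.HeightOneSpectrum (NumberField.RingOfIntegers K) in Filter.cofinite, SatakeFrobCompatibleAt ι π.1 ρ v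

/-- `closes_target` (the kit's `closes`): ISOL → SUPPLY → IMT → TRANY (item 31038 BY NAME) → W⁺|₂ → R1 (item 24805 BY NAME) → REST BY NAME.
The body is the registered birth composition `UnanchoredHighDegreeWitnessAutomorphy_proof` with `stub_unanchored`
replaced by `restE_of_pieces hI hS`. -/
theorem closes_target (hI : FiniteDepthIsolation) (hS : IsolatingDepthCongruence)
    (hIMT : IntegralModelTransferPointwise)
    (hTr : Summit.Langlands.Langlands.Theses.EllipticDegreeLadder.EllipticTransportAnyBase)
    (hW : SatakeAvatarTwo)
    (h1 : Summit.Langlands.Langlands.Theses.EllipticDegreeLadder.RankOneAutomorphy) :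
    Summit.Langlands.Langlands.Theses.TowerDoorSplit.UnanchoredHighDegreeWitnessAutomorphy := by
  have hE := restE_of_pieces hI hS
  intro K _ _ hcpt ℓ _ ι ρ hirr hgeo htw hP
  obtain ⟨hno, ⟨L, _, _, _, hgal, hsol, K₀, _, _, _, hgal₀, hsol₀, hTR, E, hEll, χ, hvia⟩, hnA, hnB5, hnB7⟩ := hP
  obtain ⟨E', hEll', χ', hvia'⟩ := hIMT K ℓ ρ L hgal hsol K₀ hgal₀ hsol₀ E χ hvia
  have hdeg : ¬ (Module.finrank ℚ K₀ ≤ 5) := fun hle =>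
    hno ⟨L, inferInstance, inferInstance, inferInstance, hgal, hsol, K₀, inferInstance, inferInstance, inferInstance, hgal₀, hsol₀, hTR, hle, E, hEll, χ, hvia⟩
  have hA : ¬ ((IsGalois ℚ K₀ ∧ (∀ σ τ : K₀ ≃ₐ[ℚ] K₀, σ * τ = τ * σ) ∧ ¬ ((3 : ℤ) ∣ NumberField.discr K₀) ∧ ¬ ((5 : ℤ) ∣ NumberField.discr K₀) ∧ ¬ ((7 : ℤ) ∣ NumberField.discr K₀)) ∨ (∃ p : ℕ, p.Prime ∧ Literature.NumberTheory.Automorphic.Thorne2019.IsInCyclotomicZpExtension p K₀)) := fun h =>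
    hnA ⟨L, inferInstance, inferInstance, inferInstance, hgal, hsol, K₀, inferInstance, inferInstance, inferInstance, hgal₀, hsol₀, hTR, h, E', hEll', χ', hvia'⟩
  have hB5 : ¬ (¬ IsSquare (5 : K₀) ∧ ∃ F : IntermediateField ℚ K₀, Module.finrank ℚ F ≤ 5 ∧ IsGalois F K₀ ∧ IsSolvable (K₀ ≃ₐ[F] K₀) ∧ Odd (Module.finrank F K₀) ∧ ∀ x y : K₀, (Literature.NumberTheory.Automorphic.Thorne2019.E₁.baseChange K₀).toAffine.Equation x y → x ∈ Set.range (algebraMap F K₀) ∧ y ∈ Set.range (algebraMap F K₀)) := fun h =>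
    hnB5 ⟨L, inferInstance, inferInstance, inferInstance, hgal, hsol, K₀, inferInstance, inferInstance, inferInstance, hgal₀, hsol₀, hTR, h, E', hEll', χ', hvia'⟩
  have hB7 : ¬ (¬ ((7 : ℤ) ∣ NumberField.discr K₀) ∧ ∃ F : IntermediateField ℚ K₀, Module.finrank ℚ F ≤ 5 ∧ IsGalois F K₀ ∧ IsSolvable (K₀ ≃ₐ[F] K₀) ∧ Odd (Module.finrank F K₀) ∧ ∀ x y : K₀, ((⟨1, 0, 0, -4, -1⟩ : WeierstrassCurve ℚ).baseChange K₀).toAffine.Equation x y → x ∈ Set.range (algebraMap F K₀) ∧ y ∈ Set.range (algebraMap F K₀)) := fun h =>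
    hnB7 ⟨L, inferInstance, inferInstance, inferInstance, hgal, hsol, K₀, inferInstance, inferInstance, inferInstance, hgal₀, hsol₀, hTR, h, E', hEll', χ', hvia'⟩
  exact hTr hW h1 K hcpt ℓ ι ρ hirr hgeo htw L hgal hsol K₀ hgal₀ hsol₀ E χ hvia (fun E₀ hΔ => hE K₀ hTR hdeg hA hB5 hB7 E₀ hΔ)

/-- W⁺|₂ (the TYPE of `stub_avatar2`) is the `n = 2` instance of the host item
`EllipticDegreeLadder.SatakeAvatarExistence` (W⁺, stmt-Langlands-17415) BY NAME. -/
theorem satakeAvatarTwo_of_host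
    (h : Summit.Langlands.Langlands.Theses.EllipticDegreeLadder.SatakeAvatarExistence) : SatakeAvatarTwo :=
  fun K _ _ hcpt π => h K 2 hcpt (by norm_num) π

/-- `closes_target` with every transport hypothesis an ITEM BY NAME except the integral-model glue IMT:
ISOL → SUPPLY → IMT → TRANY (31038) → W⁺ (17415) → R1 (24805) → REST. -/
theorem closes_byName (hI : FiniteDepthIsolation) (hS : IsolatingDepthCongruence)
    (hIMT : IntegralModelTransferPointwise)
    (hTr : Summit.Langlands.Langlands.Theses.EllipticDegreeLadder.EllipticTransportAnyBase)
    (hW : Summit.Langlands.Langlands.Theses.EllipticDegreeLadder.SatakeAvatarExistence)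
    (h1 : Summit.Langlands.Langlands.Theses.EllipticDegreeLadder.RankOneAutomorphy) :
    Summit.Langlands.Langlands.Theses.TowerDoorSplit.UnanchoredHighDegreeWitnessAutomorphy :=
  closes_target hI hS hIMT hTr (satakeAvatarTwo_of_host hW) h1

/-! ## §5 Necessity certificates: the split is exact modulo one print junction -/

/-- REST_E ⇒ ISOL: depth `0` isolates a modular curve. -/
theorem isolation_of_modularE (h : UnanchoredHighDegreeModularE) : FiniteDepthIsolation := by
  rw [modularE_iff_box] at h
  intro K₀ _ _ hbox E hΔ p _ _
  exact ⟨0, fun _ => h K₀ hbox E hΔ⟩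

/-- junction LGC (PRINT: strong multiplicity one + Carayol 1986 local–global compatibility at places of good
reduction + Néron–Ogg–Shafarevich): the weight-2 `π` attached to an integral `E` over a totally real field by an
a.e. Hecke–Frobenius identity is spherical at every place of good reduction of `E` away from any chosen `p`. -/
def WeightTwoLocalGlobal : Prop :=
  ∀ (K₀ : Type) [Field K₀] [NumberField K₀], NumberField.IsTotallyReal K₀ →
    ∀ (E : WeierstrassCurve (𝓞 K₀)) (hF : isCompact_glFiniteIntegralLevel 2 K₀)
      (π : CuspidalAutomorphicRepData 2 K₀ hF), π.1.HasWeightZero →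
      (∀ᶠ w : HeightOneSpectrum (𝓞 K₀) in Filter.cofinite, ∃ α : Multiset ℂ,
          π.1.HasSatakeParamAt w α ∧ ((Real.sqrt w.residueCard : ℝ) : ℂ) * α.sum = (frobTraceAt E w : ℂ)) →
      ∀ (p : ℕ) (w : HeightOneSpectrum (𝓞 K₀)), (p : 𝓞 K₀) ∉ w.asIdeal →
        (E.baseChange K₀).HasGoodReductionAt w → ∃ α : Multiset ℂ, π.1.HasSatakeParamAt w α

/-- ORD∞ ∧ LGC ∧ REST_E ⇒ SUPPLY: a modular non-CM curve is its own approximant at every depth (`t_w = a_w(E) ∈ ℤ`,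
no square roots needed) at any of its (infinitely many, ORD∞) ordinary primes, in particular at the isolating depth. -/
theorem supply_of_modularE
    (hord : Literature.NumberTheory.EllipticCurves.infinite_setOf_prime_goodOrdinaryAbove) (hLG : WeightTwoLocalGlobal)
    (h : UnanchoredHighDegreeModularE) : IsolatingDepthCongruence := by
  rw [modularE_iff_box] at h
  intro K₀ _ _ hbox E hΔ hCM
  rcases h K₀ hbox E hΔ with hcm | ⟨hF, π, hwt, hae⟩
  · exact absurd hcm hCM
  haveI := isElliptic_baseChange_of_delta_ne_zero E hΔ
  obtain ⟨p, hp, hpord⟩ := (hord K₀ (E.baseChange K₀)).nonempty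
  haveI hpF : Fact p.Prime := ⟨hp⟩
  obtain ⟨ι⟩ := PadicAlgCl.nonempty_ringEquiv_complex (p := p)
  refine ⟨p, hpF, hpord, hF, π, ι, ∅, hwt, by simp, fun w hw hgood => hLG K₀ hbox.1 E hF π hwt hae p w hw hgood, ?_⟩
  refine hae.mono ?_
  rintro w ⟨α, hα, hsum⟩
  refine ⟨α, (frobTraceAt E w : PadicAlgCl p), hα, by simpa using hsum, ?_, by simp⟩
  exact intCast_mem _ _

/-- EXACTNESS modulo the two print junctions: REST_E ⟺ ISOL ∧ SUPPLY. -/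
theorem restE_iff_pieces
    (hord : Literature.NumberTheory.EllipticCurves.infinite_setOf_prime_goodOrdinaryAbove) (hLG : WeightTwoLocalGlobal) :
    UnanchoredHighDegreeModularE ↔ FiniteDepthIsolation ∧ IsolatingDepthCongruence :=
  ⟨fun h => ⟨isolation_of_modularE h, supply_of_modularE hord hLG h⟩, fun h => restE_of_pieces h.1 h.2⟩

/-! ## §6 Sanity: the depth currency is not vacuous -/

/-- The isolating depth isolates, as soon as some depth does. -/
theorem isolationDepth_spec {K₀ : Type} [Field K₀] [NumberField K₀] {E : WeierstrassCurve (𝓞 K₀)}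
    {p : ℕ} [Fact p.Prime] (h : ∃ C : ℕ, (HasDepthApproximant K₀ E p C → IsModularEllipticCurve K₀ E)) :
    HasDepthApproximant K₀ E p (isolationDepth K₀ E p) → IsModularEllipticCurve K₀ E :=
  Nat.sInf_mem (s := {C : ℕ | HasDepthApproximant K₀ E p C → IsModularEllipticCurve K₀ E}) h

/-- Isolation is upward closed in the depth: if depth `C` isolates then so does every `C' ≥ C`. -/
theorem isolates_of_le {K₀ : Type} [Field K₀] [NumberField K₀] {E : WeierstrassCurve (𝓞 K₀)}
    {p : ℕ} [Fact p.Prime] {C C' : ℕ} (hle : C ≤ C')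
    (h : HasDepthApproximant K₀ E p C → IsModularEllipticCurve K₀ E) :
    HasDepthApproximant K₀ E p C' → IsModularEllipticCurve K₀ E :=
  fun h' => h (h'.mono hle)

end Summit.Langlands.Langlands.Theorems.DepthIsolationSplit
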